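import Summits.Ventures.LatticeQCDFlow.Exactness.IMHModeRenewal
import HarnessLib

/-!
# The exact burn-in law of a cold-started exact sampler: time averages forget the mode like `w(x₀)/T`

HONEST FRAMING: exact (Metropolis-corrected) sampling algorithms for lattice gauge theory;
figures of merit are autocorrelation/cost numbers at stated couplings and volumes; no
continuum-physics claim.

Venture `LatticeQCDFlow` (cell pub-lqcd), topic `Exactness`; FANOUT row 30 (lean-1, GEN-31).  NEW WORK of the
cell, general state space.  `Exactness/IMHModeRenewal.lean` (this generation) computed the law of the flow-MCMC
chain `K = indepMH q w` started at a mode `x₀` of the normalised weight `w`: `δ_{x₀}K^t = (1 − r^t)·π + r^t·δ_{x₀}`,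
`r = 1 − 1/w(x₀)`, so every observable's expectation is `π(f) + r^t·(f(x₀) − π(f))`.  Practitioners do not
look at one time `t`: they AVERAGE a run of length `T` started cold.  Here the bias of that average is computed
EXACTLY and bracketed two-sidedly:

* §1 bookkeeping on the geometric sum `S_T = Σ_{t<T} r^t`: **`geom_sum_mode_eq`** `S_T = w(x₀)·(1 − r^T)`;
  Bernoulli gives `r^T ≤ 1/(1 + T/w(x₀))`; hence
  **`geom_sum_mode_ge`** / **`geom_sum_mode_le_card`** / **`geom_sum_mode_le_weight`**:
  `T/(1 + T/w(x₀)) ≤ S_T ≤ min(T, w(x₀))` — two-sided within a factor `2`.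
* §2 **`sum_integral_iterate_bind_indepMH_dirac_mode_sub`** — THE EXACT BURN-IN LAW: for every `π`-integrable
  `f`, `Σ_{t<T} (E_{x₀} f(X_t) − π f) = (f(x₀) − π f)·S_T = (f(x₀) − π f)·w(x₀)·(1 − r^T)`
  (**`…_eq_weight`**); the expected time average of a cold-started run of length `T` is biased by EXACTLY
  `(f(x₀) − π f)·w(x₀)(1 − r^T)/T`.
* §3 two-sided, for every observable at once: **`abs_sum_bias_mode_le`** `|Σ_{t<T} bias_t| ≤ |f(x₀) − π f|·min(T, w(x₀))`
  and **`abs_sum_bias_mode_ge`** `|Σ_{t<T} bias_t| ≥ |f(x₀) − π f|·T/(1 + T/w(x₀))`; i.e. the time-average bias is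
  `|f(x₀) − π f|·w(x₀)/(T + w(x₀))` up to a factor `2` — it decays like `w(x₀)/T`, NOT geometrically.
* §4 the burn-in length for relative bias `ε`: **`sum_bias_mode_le_of_weight_le`** — `T·ε ≥ w(x₀)` suffices for
  `|time-average bias| ≤ ε·|f(x₀) − π f|`; **`weight_le_of_sum_bias_mode_le`** — conversely, if the time-average
  bias is `≤ ε·|f(x₀) − π f|` for some `f` with `f(x₀) ≠ π f`, then `w(x₀)·(1 − ε) ≤ ε·T`.  THE BURN-IN OF A
  COLD-STARTED RUN IS `w(x₀)/ε` STEPS UP TO THE FACTOR `1 − ε`, for every observable not already unbiased at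
  the mode — polynomial in `1/ε` where the ε-mixing time (`IMHMixingWindow`) is `w(x₀)·log(1/ε)`.

Reading (gauge files of this generation): for both exact gauge samplers `w(cold) = 1/A(cold)` (`c^{#B}M^k/Z`
resp. `∏_ℓ c_{#C_ℓ}/Z`), so a cold-started run must be `≳ c^{#B}M^k/(εZ)` sweeps long before its plaquette (or
any other observable) is biased by less than `ε` of its initial offset — exponential in `L^d` for `d ≥ 3`
(`AutoregressiveGaugeColdEscapeDimension`).  NOT CLAIMED: the variance / mean-square error of the time average
(needs two-time laws); non-modal starts.

No `sorry`, no new definitions, nothing cited as a fact.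
-/

noncomputable section

namespace Summit.Ventures.LatticeQCDFlow.Exactness

open MeasureTheory ProbabilityTheory Function Finset
open scoped ENNReal

variable {Ω : Type*} [MeasurableSpace Ω] [MeasurableSingletonClass Ω]
variable {q : Measure Ω} [IsProbabilityMeasure q] {w : Ω → ℝ}

/-! ## §1 The geometric sum `S_T = Σ_{t<T} r^t`, `r = 1 − 1/w(x₀)` -/

omit [MeasurableSingletonClass Ω] in
/-- **`S_T = w(x₀)·(1 − r^T)`** for the normalised weight at a mode (`w(x₀) ≥ 1`). [ours] -/
theorem geom_sum_mode_eq (hw0 : ∀ y, 0 < w y) {x₀ : Ω} (hmax : ∀ y, w y ≤ w x₀)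
    [IsProbabilityMeasure (q.withDensity fun y => ENNReal.ofReal (w y))] (T : ℕ) :
    ∑ t ∈ range T, (1 - (w x₀)⁻¹) ^ t = w x₀ * (1 - (1 - (w x₀)⁻¹) ^ T) := by
  have hW : 1 ≤ w x₀ := one_le_of_mode (q := q) hmax
  have hWpos : 0 < w x₀ := hw0 x₀
  have hr1 : 1 - (w x₀)⁻¹ ≠ 1 := by
    intro h
    have : (w x₀)⁻¹ = 0 := by linarith
    exact (inv_pos.2 hWpos).ne' this
  rw [geom_sum_eq hr1]
  field_simp
  ring

omit [MeasurableSingletonClass Ω] in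
/-- `S_T ≤ T`. [ours] -/
theorem geom_sum_mode_le_card (hw0 : ∀ y, 0 < w y) {x₀ : Ω} (hmax : ∀ y, w y ≤ w x₀)
    [IsProbabilityMeasure (q.withDensity fun y => ENNReal.ofReal (w y))] (T : ℕ) :
    ∑ t ∈ range T, (1 - (w x₀)⁻¹) ^ t ≤ T := by
  have hW : 1 ≤ w x₀ := one_le_of_mode (q := q) hmax
  have hr0 : 0 ≤ 1 - (w x₀)⁻¹ := sub_nonneg.2 (inv_le_one_of_one_le₀ hW)
  have hr1 : 1 - (w x₀)⁻¹ ≤ 1 := sub_le_self _ (inv_nonneg.mpr (hw0 x₀).le)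
  calc ∑ t ∈ range T, (1 - (w x₀)⁻¹) ^ t ≤ ∑ _t ∈ range T, (1 : ℝ) :=
        sum_le_sum fun t _ => pow_le_one₀ hr0 hr1
    _ = T := by rw [sum_const, card_range, nsmul_eq_mul, mul_one]

omit [MeasurableSingletonClass Ω] in
/-- `S_T ≤ w(x₀)` (the whole series sums to `w(x₀)`). [ours] -/
theorem geom_sum_mode_le_weight (hw0 : ∀ y, 0 < w y) {x₀ : Ω} (hmax : ∀ y, w y ≤ w x₀)
    [IsProbabilityMeasure (q.withDensity fun y => ENNReal.ofReal (w y))] (T : ℕ) :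
    ∑ t ∈ range T, (1 - (w x₀)⁻¹) ^ t ≤ w x₀ := by
  have hW : 1 ≤ w x₀ := one_le_of_mode (q := q) hmax
  have hr0 : 0 ≤ 1 - (w x₀)⁻¹ := sub_nonneg.2 (inv_le_one_of_one_le₀ hW)
  rw [geom_sum_mode_eq (q := q) hw0 hmax T]
  have h : 1 - (1 - (w x₀)⁻¹) ^ T ≤ 1 := sub_le_self _ (pow_nonneg hr0 T)
  calc w x₀ * (1 - (1 - (w x₀)⁻¹) ^ T) ≤ w x₀ * 1 := mul_le_mul_of_nonneg_left h (hw0 x₀).le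
    _ = w x₀ := mul_one _

omit [MeasurableSingletonClass Ω] in
/-- **`S_T ≥ T/(1 + T/w(x₀))`** — with the two ceilings, `S_T ≍ T·w(x₀)/(T + w(x₀))` within a factor `2`. [ours] -/
theorem geom_sum_mode_ge (hw0 : ∀ y, 0 < w y) {x₀ : Ω} (hmax : ∀ y, w y ≤ w x₀)
    [IsProbabilityMeasure (q.withDensity fun y => ENNReal.ofReal (w y))] (T : ℕ) :
    T / (1 + T * (w x₀)⁻¹) ≤ ∑ t ∈ range T, (1 - (w x₀)⁻¹) ^ t := by
  have hW : 1 ≤ w x₀ := one_le_of_mode (q := q) hmax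
  have hWpos : 0 < w x₀ := hw0 x₀
  have ha0 : 0 ≤ (w x₀)⁻¹ := inv_nonneg.mpr hWpos.le
  have ha1 : (w x₀)⁻¹ ≤ 1 := inv_le_one_of_one_le₀ hW
  have hd : 0 < 1 + (T : ℝ) * (w x₀)⁻¹ := by positivity
  -- Bernoulli: `(1 − a)^T ≤ 1/(1 + T a)` for `a = 1/w(x₀) ∈ [0, 1]` (as in the tree's
  -- `Literature…LWERegevAsymptotics.one_sub_pow_le_inv`, inlined to keep the import closure topical)
  have hpow : (1 - (w x₀)⁻¹) ^ T ≤ 1 / (1 + T * (w x₀)⁻¹) := by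
    have hB : 1 + (T : ℝ) * (w x₀)⁻¹ ≤ (1 + (w x₀)⁻¹) ^ T := one_add_mul_le_pow (by linarith) T
    rw [le_div_iff₀ hd]
    have h1 : (1 - (w x₀)⁻¹) ^ T * (1 + (w x₀)⁻¹) ^ T ≤ 1 := by
      rw [← mul_pow]
      exact pow_le_one₀ (by nlinarith) (by nlinarith)
    calc (1 - (w x₀)⁻¹) ^ T * (1 + T * (w x₀)⁻¹) ≤ (1 - (w x₀)⁻¹) ^ T * (1 + (w x₀)⁻¹) ^ T :=
          mul_le_mul_of_nonneg_left hB (pow_nonneg (sub_nonneg.2 ha1) T)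
      _ ≤ 1 := h1
  rw [geom_sum_mode_eq (q := q) hw0 hmax T]
  -- `w(1 − r^T) ≥ w(1 − 1/(1+Ta)) = w·Ta/(1+Ta) = T/(1+Ta)` with `a = 1/w`
  have h1 : (T : ℝ) / (1 + T * (w x₀)⁻¹) = w x₀ * (1 - 1 / (1 + T * (w x₀)⁻¹)) := by
    field_simp
    ring
  rw [h1]
  exact mul_le_mul_of_nonneg_left (sub_le_sub_left hpow 1) hWpos.le

/-! ## §2 The exact burn-in law -/

/-- **THE EXACT BURN-IN LAW.**  `w` measurable, positive, normalised, maximal at `x₀`; `f` `π`-integrable.  The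
summed bias of a cold-started run of length `T` is EXACTLY `(f(x₀) − π f)·S_T`, `S_T = Σ_{t<T}(1 − 1/w(x₀))^t`.
[ours] -/
theorem sum_integral_iterate_bind_indepMH_dirac_mode_sub (hw : Measurable w) (hw0 : ∀ y, 0 < w y) {x₀ : Ω}
    (hmax : ∀ y, w y ≤ w x₀) [IsProbabilityMeasure (q.withDensity fun y => ENNReal.ofReal (w y))] (T : ℕ)
    {f : Ω → ℝ} (hf : Integrable f (q.withDensity fun y => ENNReal.ofReal (w y))) :
    ∑ t ∈ range T, (∫ x, f x ∂((fun m : Measure Ω => m.bind (indepMH q w))^[t] (Measure.dirac x₀)) -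
        ∫ x, f x ∂(q.withDensity fun y => ENNReal.ofReal (w y))) =
      (f x₀ - ∫ x, f x ∂(q.withDensity fun y => ENNReal.ofReal (w y))) * ∑ t ∈ range T, (1 - (w x₀)⁻¹) ^ t := by
  rw [mul_sum]
  refine sum_congr rfl fun t _ => ?_
  rw [integral_iterate_bind_indepMH_dirac_mode_sub hw hw0 hmax t hf, mul_comm]

/-- **… in closed form**: `Σ_{t<T} (E_{x₀} f(X_t) − π f) = (f(x₀) − π f)·w(x₀)·(1 − r^T)`; the expected time
average of the run is biased by exactly `(f(x₀) − π f)·w(x₀)(1 − r^T)/T`. [ours] -/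
theorem sum_integral_iterate_bind_indepMH_dirac_mode_sub_eq_weight (hw : Measurable w) (hw0 : ∀ y, 0 < w y)
    {x₀ : Ω} (hmax : ∀ y, w y ≤ w x₀) [IsProbabilityMeasure (q.withDensity fun y => ENNReal.ofReal (w y))]
    (T : ℕ) {f : Ω → ℝ} (hf : Integrable f (q.withDensity fun y => ENNReal.ofReal (w y))) :
    ∑ t ∈ range T, (∫ x, f x ∂((fun m : Measure Ω => m.bind (indepMH q w))^[t] (Measure.dirac x₀)) -
        ∫ x, f x ∂(q.withDensity fun y => ENNReal.ofReal (w y))) =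
      (f x₀ - ∫ x, f x ∂(q.withDensity fun y => ENNReal.ofReal (w y))) *
        (w x₀ * (1 - (1 - (w x₀)⁻¹) ^ T)) := by
  rw [sum_integral_iterate_bind_indepMH_dirac_mode_sub hw hw0 hmax T hf, geom_sum_mode_eq (q := q) hw0 hmax T]

/-! ## §3 Two-sided: the summed bias is `|f(x₀) − π f|·T·w(x₀)/(T + w(x₀))` within a factor `2` -/

/-- **Ceiling**: `|Σ_{t<T} bias_t| ≤ |f(x₀) − π f|·min(T, w(x₀))` — the summed bias never exceeds `w(x₀)` initial
offsets, however long the run. [ours] -/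
theorem abs_sum_bias_mode_le (hw : Measurable w) (hw0 : ∀ y, 0 < w y) {x₀ : Ω}
    (hmax : ∀ y, w y ≤ w x₀) [IsProbabilityMeasure (q.withDensity fun y => ENNReal.ofReal (w y))] (T : ℕ)
    {f : Ω → ℝ} (hf : Integrable f (q.withDensity fun y => ENNReal.ofReal (w y))) :
    |∑ t ∈ range T, (∫ x, f x ∂((fun m : Measure Ω => m.bind (indepMH q w))^[t] (Measure.dirac x₀)) -
        ∫ x, f x ∂(q.withDensity fun y => ENNReal.ofReal (w y)))| ≤
      |f x₀ - ∫ x, f x ∂(q.withDensity fun y => ENNReal.ofReal (w y))| * min (T : ℝ) (w x₀) := by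
  have hW : 1 ≤ w x₀ := one_le_of_mode (q := q) hmax
  have hr0 : 0 ≤ 1 - (w x₀)⁻¹ := sub_nonneg.2 (inv_le_one_of_one_le₀ hW)
  have hS0 : 0 ≤ ∑ t ∈ range T, (1 - (w x₀)⁻¹) ^ t := sum_nonneg fun t _ => pow_nonneg hr0 t
  rw [sum_integral_iterate_bind_indepMH_dirac_mode_sub hw hw0 hmax T hf, abs_mul, abs_of_nonneg hS0]
  exact mul_le_mul_of_nonneg_left
    (le_min (geom_sum_mode_le_card (q := q) hw0 hmax T) (geom_sum_mode_le_weight (q := q) hw0 hmax T))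
    (abs_nonneg _)

/-- **Floor**: `|Σ_{t<T} bias_t| ≥ |f(x₀) − π f|·T/(1 + T/w(x₀))` — the time-average bias is at least
`|f(x₀) − π f|/(1 + T/w(x₀))`: it decays like `w(x₀)/T`, not geometrically. [ours] -/
theorem abs_sum_bias_mode_ge (hw : Measurable w) (hw0 : ∀ y, 0 < w y) {x₀ : Ω}
    (hmax : ∀ y, w y ≤ w x₀) [IsProbabilityMeasure (q.withDensity fun y => ENNReal.ofReal (w y))] (T : ℕ)
    {f : Ω → ℝ} (hf : Integrable f (q.withDensity fun y => ENNReal.ofReal (w y))) :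
    |f x₀ - ∫ x, f x ∂(q.withDensity fun y => ENNReal.ofReal (w y))| * (T / (1 + T * (w x₀)⁻¹)) ≤
      |∑ t ∈ range T, (∫ x, f x ∂((fun m : Measure Ω => m.bind (indepMH q w))^[t] (Measure.dirac x₀)) -
        ∫ x, f x ∂(q.withDensity fun y => ENNReal.ofReal (w y)))| := by
  have hW : 1 ≤ w x₀ := one_le_of_mode (q := q) hmax
  have hr0 : 0 ≤ 1 - (w x₀)⁻¹ := sub_nonneg.2 (inv_le_one_of_one_le₀ hW)
  have hS0 : 0 ≤ ∑ t ∈ range T, (1 - (w x₀)⁻¹) ^ t := sum_nonneg fun t _ => pow_nonneg hr0 t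
  rw [sum_integral_iterate_bind_indepMH_dirac_mode_sub hw hw0 hmax T hf, abs_mul, abs_of_nonneg hS0]
  exact mul_le_mul_of_nonneg_left (geom_sum_mode_ge (q := q) hw0 hmax T) (abs_nonneg _)

/-! ## §4 The burn-in length for relative bias `ε` is `w(x₀)/ε`, up to the factor `1 − ε` -/

/-- **`T·ε ≥ w(x₀)` suffices**: then the time-average bias of EVERY `π`-integrable observable is at most `ε`
times its initial offset: `|Σ_{t<T} bias_t| ≤ ε·T·|f(x₀) − π f|`. [ours] -/
theorem sum_bias_mode_le_of_weight_le (hw : Measurable w) (hw0 : ∀ y, 0 < w y) {x₀ : Ω}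
    (hmax : ∀ y, w y ≤ w x₀) [IsProbabilityMeasure (q.withDensity fun y => ENNReal.ofReal (w y))] {T : ℕ}
    {ε : ℝ} (hT : w x₀ ≤ T * ε) {f : Ω → ℝ} (hf : Integrable f (q.withDensity fun y => ENNReal.ofReal (w y))) :
    |∑ t ∈ range T, (∫ x, f x ∂((fun m : Measure Ω => m.bind (indepMH q w))^[t] (Measure.dirac x₀)) -
        ∫ x, f x ∂(q.withDensity fun y => ENNReal.ofReal (w y)))| ≤
      ε * T * |f x₀ - ∫ x, f x ∂(q.withDensity fun y => ENNReal.ofReal (w y))| := by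
  have h := abs_sum_bias_mode_le hw hw0 hmax T hf
  have hmin : min (T : ℝ) (w x₀) ≤ ε * T := (min_le_right _ _).trans (by rw [mul_comm]; exact hT)
  calc _ ≤ |f x₀ - ∫ x, f x ∂(q.withDensity fun y => ENNReal.ofReal (w y))| * min (T : ℝ) (w x₀) := h
    _ ≤ |f x₀ - ∫ x, f x ∂(q.withDensity fun y => ENNReal.ofReal (w y))| * (ε * T) :=
        mul_le_mul_of_nonneg_left hmin (abs_nonneg _)
    _ = ε * T * |f x₀ - ∫ x, f x ∂(q.withDensity fun y => ENNReal.ofReal (w y))| := by ring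

/-- **… and `T·ε ≥ (1 − ε)·w(x₀)` is necessary**: if for some observable NOT already unbiased at the mode
(`f(x₀) ≠ π f`) the time-average bias of a run of length `T ≥ 1` is at most `ε` times the initial offset, then
`w(x₀)·(1 − ε) ≤ ε·T`.  The burn-in of a cold-started exact sampler is `w(x₀)/ε` steps up to the factor `1 − ε` —
polynomial, not logarithmic, in `1/ε`. [ours] -/
theorem weight_le_of_sum_bias_mode_le (hw : Measurable w) (hw0 : ∀ y, 0 < w y) {x₀ : Ω}
    (hmax : ∀ y, w y ≤ w x₀) [IsProbabilityMeasure (q.withDensity fun y => ENNReal.ofReal (w y))] {T : ℕ}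
    (hT : 0 < T) {ε : ℝ} {f : Ω → ℝ} (hf : Integrable f (q.withDensity fun y => ENNReal.ofReal (w y)))
    (hfx : f x₀ ≠ ∫ x, f x ∂(q.withDensity fun y => ENNReal.ofReal (w y)))
    (hbias : |∑ t ∈ range T, (∫ x, f x ∂((fun m : Measure Ω => m.bind (indepMH q w))^[t] (Measure.dirac x₀)) -
        ∫ x, f x ∂(q.withDensity fun y => ENNReal.ofReal (w y)))| ≤
      ε * T * |f x₀ - ∫ x, f x ∂(q.withDensity fun y => ENNReal.ofReal (w y))|) :
    w x₀ * (1 - ε) ≤ ε * T := by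
  have hWpos : 0 < w x₀ := hw0 x₀
  have hTr : 0 < (T : ℝ) := by exact_mod_cast hT
  have hδ : 0 < |f x₀ - ∫ x, f x ∂(q.withDensity fun y => ENNReal.ofReal (w y))| :=
    abs_pos.2 (sub_ne_zero.2 hfx)
  have hge := abs_sum_bias_mode_ge hw hw0 hmax T hf
  have h1 : (T : ℝ) / (1 + T * (w x₀)⁻¹) ≤ ε * T := by
    have h2 := hge.trans hbias
    rw [mul_comm (ε * T)] at h2
    exact le_of_mul_le_mul_left h2 hδ
  have hd : 0 < 1 + (T : ℝ) * (w x₀)⁻¹ := by positivity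
  rw [div_le_iff₀ hd, show ε * T * (1 + T * (w x₀)⁻¹) = T * (ε * (1 + T * (w x₀)⁻¹)) by ring] at h1
  have h5 : 1 ≤ ε * (1 + T * (w x₀)⁻¹) := (le_mul_iff_one_le_right hTr).1 h1
  have h6 : w x₀ * 1 ≤ w x₀ * (ε * (1 + T * (w x₀)⁻¹)) := mul_le_mul_of_nonneg_left h5 hWpos.le
  have h7 : w x₀ * (ε * (1 + T * (w x₀)⁻¹)) = ε * w x₀ + ε * T := by
    field_simp
  rw [mul_one, h7] at h6
  linarith

end Summit.Ventures.LatticeQCDFlow.Exactness
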